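import Literature.NumberTheory.EllipticCurves.Curve6137MuDescentSelmer
import Literature.NumberTheory.EllipticCurves.Curve6137PhiSideSelmer
import Literature.NumberTheory.EllipticCurves.IsogenyCompProofs
import Literature.NumberTheory.EllipticCurves.IsogenyVariableChangeProofs
import Literature.NumberTheory.EllipticCurves.IsogenyDualProofs
import Literature.NumberTheory.EllipticCurves.ShaIsogenyProofs
import Literature.NumberTheory.EllipticCurves.TwoIsogenyShaTwoTorsion
import Literature.NumberTheory.EllipticCurves.TorsionCardinality
import HarnessLib

/-!
# `Ш(E/ℚ)[3] = 0` for the cross-prime carrier `y² − 21xy + 6137y = x³` (complete `3`-isogeny descent,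
# Cohen–Pazuki 2009: both Selmer groups are filled by rational points; Silverman X.4.2, III.6.1)

Topic `NumberTheory/EllipticCurves`. Conclusion of the `3`-isogeny descent of the carrier
`E = threeTorsionModel (−21/2) (6137/2)` (rank `2`, `t_2 = 0`: `Curve6137TwoIsogenyDescent`):

* `Curve6137MuDescentSelmer`: `Ш(V/ℚ) ∩ ker f_* = 0` for the Cohen–Pazuki model
  `V = cpCurve (−21/2) 9720 = ⟨1, −147, 0, 0⟩ • Ê` and any equivariant surjection with kernel `⟨T̂⟩`;
* `Curve6137PhiSideSelmer`: `Ш(E/ℚ) ∩ ker φ_* = 0` for Vélu's `φ : E → Ê`.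

Here, with `φ' : E → Ê ≅ V` (Vélu followed by the translation, an `Isogeny`) and its dual `ψ`
(`Isogeny.exists_dual_of_isElliptic`, `ψ ∘ φ' = [3]`): the kernel of `ψ` is `⟨T̂⟩` (`ψ(T̂) = O` by the
`ε`-trick of `MuThreeTorsorImage.apply_T_eq_zero_of_fixed`, `√−3 ∉ ℚ`; and `#E[3] = 9`,
`TorsionCardinality`), so for `c ∈ Ш(E/ℚ)` with `3c = 0`: `φ'_* c ∈ Ш(V) ∩ ker ψ_* = 0`, hence
`φ_* c = 0`, hence `c = 0`:

* **`Carrier6137.forall_mem_sha_three_nsmul_eq_zero`** — `Ш(E/ℚ)[3] = 0`;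
* **`Carrier6137.shaCorank_three_threeTorsionModel`** — `t_3(E) = corank_{ℤ₃} Ш(E/ℚ)[3^∞] = 0`;
  `Carrier6137.primaryComponent_sha_three_threeTorsionModel` — `Ш(E/ℚ)[3^∞] = ⊥`.

With `t_2(E) = 0` (`Carrier6137.shaCorank_two`, on the `ℚ`-isomorphic model `[0, −3891, 0, 3950784, 0]`)
this is the first CROSS-PRIME CELL of route ShaPrimaryTransfer: a rank-`2` non-CM curve with
`t_2 = t_3 = 0`, both certified by descent. No named facts; everything proved.

## References

* [CohenPazuki2009] H. Cohen, F. Pazuki, Acta Arith. 140 (2009), Prop. 1.4, Thm. 2.1, Prop. 2.2.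
* [SilvermanAEC2009] J. H. Silverman, *AEC*, Thm. III.6.1–6.2, Cor. III.6.4, Thm. X.4.2.
-/

noncomputable section

open scoped Classical

open WeierstrassCurve

namespace Literature.NumberTheory.EllipticCurves

namespace Carrier6137

open MordellDescent ThreeTorsionDescent CPMuDescent MuThreeKernel GaloisRepresentations

/-! ## The isogeny `φ' : E → V = ⟨1, −147, 0, 0⟩ • Ê` and the kernel point `T̂` of its dual -/

/-- `Ê` is elliptic. [cite: CohenPazuki2009, §1.2] -/
theorem isElliptic_codomain : (threeIsogenyCodomain (-21 / 2 : ℚ) (6137 / 2)).IsElliptic := by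
  haveI := isElliptic_W; exact isElliptic_threeIsogenyCodomain

/-- The `μ₃`-kernel datum and the sharp `μ₃`-descent, for ANY model `X = cpCurve (−21/2) 9720`
(so that they transport along `cpCurve (−21/2) 9720 = ⟨1, −147, 0, 0⟩ • Ê`).
[cite: CohenPazuki2009, Theorem 2.1 and Proposition 2.2] -/
private theorem model_facts {X : WeierstrassCurve ℚ} (hX : cpCurve (-21 / 2 : ℚ) 9720 = X) :
    ∃ 𝒯 : MuThreeKernel X,
      ∀ {W' : WeierstrassCurve ℚ} (f : geomPoints X →+ geomPoints W')
        (hf : ∀ (σ : Field.absoluteGaloisGroup ℚ) (P : geomPoints X), f (σ • P) = σ • f P),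
        Function.Surjective f → (∀ P, f P = 0 → P = 0 ∨ P = 𝒯.T ∨ P = -𝒯.T) →
          ∀ {c : X.galH1}, c ∈ X.sha → galH1Map f hf c = 0 → c = 0 := by
  subst hX
  exact ⟨kernelDatum hb' hd', fun f hf hsurj hker _ hc h0 =>
    eq_zero_of_mem_sha_of_galH1Map_eq_zero f hf hsurj hker hc h0⟩

/-- `√−3 ∉ ℚ`: some `σ₀ ∈ Γ_ℚ` moves `√−3`. [cite: CohenPazuki2009, §1.2 (T rational iff D ∈ ℚ*²)] -/
theorem exists_galAut_theta_ne : ∃ σ₀ : Field.absoluteGaloisGroup ℚ, galAut σ₀ (theta ℚ) ≠ theta ℚ := by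
  by_contra h
  push Not at h
  obtain ⟨q, hq⟩ := exists_algebraMap_eq_of_forall_galAut (K := ℚ) h
  -- abstract over the structure map (no `Algebra ℚ K̄` instance juggling)
  have key : ∀ f : ℚ →+* AlgebraicClosure ℚ, f q = theta ℚ → False := by
    intro f hf
    have h2 : f (q ^ 2 + 3) = 0 := by
      rw [map_add, map_pow, hf, theta_sq, map_ofNat]; norm_num
    have h3 : q ^ 2 + 3 = 0 := (map_eq_zero_iff f f.injective).mp h2
    nlinarith [sq_nonneg q]
  exact key _ hq

/-! ## `Ш(E/ℚ)[3] = 0` -/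

/-- **`Ш(E/ℚ)[3] = 0` for `E = threeTorsionModel (−21/2) (6137/2)`** (`y² − 21xy + 6137y = x³` after
completing the square): every class of `Ш(E/ℚ)` killed by `3` vanishes. Both Selmer groups of the
`3`-isogeny `φ : E → Ê` and its dual are filled by rational points (`Curve6137MuDescentSelmer`,
`Curve6137PhiSideSelmer`), and `ψ ∘ φ' = [3]`. [cite: CohenPazuki2009, Proposition 2.2]
[cite: SilvermanAEC2009, Thm. X.4.2 (a) and Thm. III.6.1] -/
theorem forall_mem_sha_three_nsmul_eq_zero :
    ∀ c ∈ (threeTorsionModel (-21 / 2 : ℚ) (6137 / 2)).sha, 3 • c = 0 → c = 0 := by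
  intro c hc h3c
  haveI : (threeTorsionModel (-21 / 2 : ℚ) (6137 / 2)).IsElliptic := isElliptic_W
  haveI : (threeIsogenyCodomain (-21 / 2 : ℚ) (6137 / 2)).IsElliptic := isElliptic_codomain
  have hV := isVeluThreePair_E
  set C : VariableChange ℚ := ⟨1, -147, 0, 0⟩ with hCdef
  set X : WeierstrassCurve ℚ := C • threeIsogenyCodomain (-21 / 2 : ℚ) (6137 / 2) with hXdef
  have hX : cpCurve (-21 / 2 : ℚ) 9720 = X := cpCurve_eq_variableChange_threeIsogenyCodomain
  -- the isogeny `φ' : E → X` and its dual `ψ`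
  set φ' : Isogeny (threeTorsionModel (-21 / 2 : ℚ) (6137 / 2)) X :=
    (VariableChange.toIsogeny (threeIsogenyCodomain (-21 / 2 : ℚ) (6137 / 2)) C).comp hV.toIsogeny with hφ'
  have hφ'apply : ∀ P, φ' P = VariableChange.toIsogeny _ C (hV.toIsogeny P) := fun P => rfl
  have hdeg : φ'.degree = 3 := by
    rw [← hV.degree_toIsogeny]
    unfold Isogeny.degree
    congr 1
    rw [hφ', Isogeny.ker_comp, VariableChange.ker_toIsogeny]
    rfl
  obtain ⟨ψ, hψ⟩ := φ'.exists_dual_of_isElliptic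
  rw [hdeg] at hψ
  have hψφ : ∀ P, ψ.toAddMonoidHom (φ'.toAddMonoidHom P) = ((3 : ℕ) : ℤ) • P := fun P => hψ P
  have hφ'surj : Function.Surjective φ' := fun Q => by
    obtain ⟨R, rfl⟩ := VariableChange.toIsogeny_surjective _ C Q
    obtain ⟨P, rfl⟩ := hV.geom.pointFun_surjective R
    exact ⟨P, rfl⟩
  have hφψ : ∀ Q, φ' (ψ Q) = ((3 : ℕ) : ℤ) • Q := fun Q => by
    obtain ⟨P, rfl⟩ := hφ'surj Q
    rw [hψ, map_zsmul]
  -- the kernel datum `T̂ = (0, 9720√−3)` of `X` and the sharp descent, transported from `cpCurve`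
  obtain ⟨𝒯, hsharp⟩ := model_facts hX
  -- `ker φ' = {O, ±T}` and its points are `Γ_ℚ`-fixed
  have hkerφ' : ∀ P, φ' P = 0 ↔ P = 0 ∨ P = hV.geomT ∨ P = -hV.geomT := by
    intro P
    rw [hφ'apply, ← map_zero (VariableChange.toIsogeny (threeIsogenyCodomain (-21 / 2 : ℚ) (6137 / 2)) C),
      (VariableChange.toIsogeny_injective _ C).eq_iff, IsVeluThreePair.toIsogeny_apply]
    exact hV.geom.pointFun_eq_zero_iff P
  -- `ψ(T̂) = O`
  have hψT : ψ 𝒯.T = 0 := by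
    obtain ⟨σ₀, hσ₀⟩ := exists_galAut_theta_ne
    refine 𝒯.apply_T_eq_zero_of_fixed ψ.toAddMonoidHom ψ.equivariant (fun σ => ?_) ?_ hσ₀
    · -- `φ'(ψ T̂) = 3 T̂ = O`, so `ψ T̂ ∈ {O, ±T}` is rational
      have h0 : φ' (ψ 𝒯.T) = 0 := by
        rw [hφψ, natCast_zsmul, 𝒯.three_nsmul_T]
      rcases (hkerφ' _).mp h0 with h | h | h
      · change σ • ψ 𝒯.T = ψ 𝒯.T; rw [h, smul_zero]
      · change σ • ψ 𝒯.T = ψ 𝒯.T; rw [h, smul_geomT]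
      · change σ • ψ 𝒯.T = ψ 𝒯.T; rw [h, smul_neg, smul_geomT]
    · change (3 : ℕ) • ψ 𝒯.T = 0
      rw [← map_nsmul, 𝒯.three_nsmul_T, map_zero]
  -- `E[3] = {iT + jR₁}` with `φ'(R₁) = T̂`: nine points, `#E[3] = 9`
  obtain ⟨R₁, hR₁⟩ := hφ'surj 𝒯.T
  have h3R₁ : (3 : ℕ) • R₁ = 0 := by
    have := hψ R₁
    rw [hR₁, hψT] at this
    rw [← natCast_zsmul]; exact this.symm
  have hTT : hV.geomT + hV.geomT = -hV.geomT := hV.geom.T_add_T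
  have h3T : (3 : ℕ) • hV.geomT = 0 := by
    rw [succ_nsmul, two_nsmul, hTT, neg_add_cancel]
  have himage : ∀ Q : geomPoints (threeTorsionModel (-21 / 2 : ℚ) (6137 / 2)), (3 : ℕ) • Q = 0 →
      φ' Q = 0 ∨ φ' Q = 𝒯.T ∨ φ' Q = -𝒯.T := by
    -- the map `(i, j) ↦ iT + jR₁` is a bijection `ℤ/3 × ℤ/3 → E[3]`
    set S := AddSubgroup.torsionBy (geomPoints (threeTorsionModel (-21 / 2 : ℚ) (6137 / 2))) ((3 : ℕ) : ℤ)
      with hS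
    have hmem : ∀ Q, Q ∈ S ↔ (3 : ℕ) • Q = 0 := fun Q => AddSubgroup.torsionBy.nsmul_iff
    obtain ⟨ι₀, hι₀⟩ : ∃ ι₀ : ZMod 3 × ZMod 3 → geomPoints (threeTorsionModel (-21 / 2 : ℚ) (6137 / 2)),
        ∀ ij, ι₀ ij = ij.1.val • hV.geomT + ij.2.val • R₁ := ⟨_, fun _ => rfl⟩
    have hι₀S : ∀ ij, ι₀ ij ∈ S := fun ij => (hmem _).mpr (by
      rw [hι₀, nsmul_add, smul_comm (3 : ℕ) ij.1.val, smul_comm (3 : ℕ) ij.2.val, h3T, h3R₁, smul_zero,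
        smul_zero, add_zero])
    obtain ⟨ι, hι⟩ : ∃ ι : ZMod 3 × ZMod 3 → S, ∀ ij, (ι ij : geomPoints _) = ι₀ ij :=
      ⟨fun ij => ⟨ι₀ ij, hι₀S ij⟩, fun _ => rfl⟩
    have hφ'ι : ∀ ij : ZMod 3 × ZMod 3, φ' (ι₀ ij) = ij.2.val • 𝒯.T := by
      intro ij
      rw [hι₀, map_add, map_nsmul, map_nsmul, (hkerφ' _).mpr (Or.inr (Or.inl rfl)), smul_zero, zero_add, hR₁]
    have hιinj : Function.Injective ι := by
      intro ij ij' h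
      have h' : ι₀ ij = ι₀ ij' := by rw [← hι, ← hι, h]
      have h2 : ij.2 = ij'.2 := by
        have := congrArg φ' h'
        rw [hφ'ι, hφ'ι] at this
        exact val_nsmul_injective 𝒯.T 𝒯.T_ne_zero 𝒯.T_add_T this
      have h1 : ij.1 = ij'.1 := by
        rw [hι₀, hι₀, h2] at h'
        exact val_nsmul_injective hV.geomT hV.geomT_ne_zero hTT (add_right_cancel h')
      exact Prod.ext h1 h2
    have e : Nat.card S = 3 ^ 2 :=
      card_torsionBy_eq_sq (E := (threeTorsionModel (-21 / 2 : ℚ) (6137 / 2)).baseChange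
        (AlgebraicClosure ℚ)) (n := 3) (by norm_num)
    have hcard : Nat.card S ≤ Nat.card (ZMod 3 × ZMod 3) := by
      rw [e, Nat.card_prod, Nat.card_zmod]; norm_num
    haveI : Finite S := Nat.finite_of_card_ne_zero (by rw [e]; norm_num)
    have hιbij : Function.Bijective ι := hιinj.bijective_of_nat_card_le hcard
    intro Q hQ
    obtain ⟨ij, hij⟩ := hιbij.2 ⟨Q, (hmem Q).mpr hQ⟩
    have hQ' : Q = ι₀ ij := by rw [← hι, hij]
    rw [hQ', hφ'ι]
    have := ij.2.val_lt
    rcases (by omega : ij.2.val = 0 ∨ ij.2.val = 1 ∨ ij.2.val = 2) with h | h | h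
    · exact Or.inl (by rw [h, zero_nsmul])
    · exact Or.inr (Or.inl (by rw [h, one_nsmul]))
    · exact Or.inr (Or.inr (by rw [h, two_nsmul, 𝒯.T_add_T]))
  have hkerψ : ∀ P : geomPoints X, ψ.toAddMonoidHom P = 0 → P = 0 ∨ P = 𝒯.T ∨ P = -𝒯.T := by
    intro P hP
    obtain ⟨Q, rfl⟩ := hφ'surj P
    have h3Q : (3 : ℕ) • Q = 0 := by
      rw [← natCast_zsmul, ← hψ Q]; exact hP
    exact himage Q h3Q
  -- `φ'_* c ∈ Ш(X) ∩ ker ψ_* = 0`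
  have hc₁ : galH1Map φ'.toAddMonoidHom φ'.equivariant c ∈ X.sha :=
    galH1Map_mem_sha φ'.toAddMonoidHom φ'.equivariant φ'.hasLocalPointsMaps_toAddMonoidHom hc
  have hψc₁ : galH1Map ψ.toAddMonoidHom ψ.equivariant (galH1Map φ'.toAddMonoidHom φ'.equivariant c) = 0 := by
    rw [galH1Map_galH1Map_of_comp_eq_nsmul φ'.toAddMonoidHom φ'.equivariant ψ.toAddMonoidHom ψ.equivariant
      hψφ c, h3c]
  have hc₁0 : galH1Map φ'.toAddMonoidHom φ'.equivariant c = 0 :=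
    hsharp ψ.toAddMonoidHom ψ.equivariant ψ.surjective hkerψ hc₁ hψc₁
  -- hence `φ_* c = 0` (the translation `Ê ≅ X` is injective on `H¹`)
  have hφc : galH1Map hV.geomHom hV.geomHom_smul c = 0 := by
    -- `g ∘ toIsogeny C = id` for the inverse substitution `g`
    set ι₂ := VariableChange.toIsogeny (threeIsogenyCodomain (-21 / 2 : ℚ) (6137 / 2)) C with hι₂
    let g : geomPoints X →+ geomPoints (threeIsogenyCodomain (-21 / 2 : ℚ) (6137 / 2)) :=
      (VariableChange.pointEquivBaseChange (threeIsogenyCodomain (-21 / 2 : ℚ) (6137 / 2)) C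
        (AlgebraicClosure ℚ)).symm.toAddMonoidHom
    have hgι' : ∀ P : geomPoints (threeIsogenyCodomain (-21 / 2 : ℚ) (6137 / 2)), g (ι₂ P) = P :=
      fun P => (VariableChange.pointEquivBaseChange (threeIsogenyCodomain (-21 / 2 : ℚ) (6137 / 2)) C
        (AlgebraicClosure ℚ)).symm_apply_apply P
    have hg : ∀ (σ : Field.absoluteGaloisGroup ℚ) (Q : geomPoints X), g (σ • Q) = σ • g Q := by
      intro σ Q
      obtain ⟨P, rfl⟩ : ∃ P : geomPoints (threeIsogenyCodomain (-21 / 2 : ℚ) (6137 / 2)), ι₂ P = Q :=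
        VariableChange.toIsogeny_surjective _ C Q
      rw [← ι₂.map_smul σ P, hgι', hgι']
    have hgι : ∀ P, g (ι₂.toAddMonoidHom P) = ((1 : ℕ) : ℤ) • P := fun P => by
      rw [Nat.cast_one, one_zsmul]
      exact hgι' P
    have e : galH1Map φ'.toAddMonoidHom φ'.equivariant c =
        galH1Map ι₂.toAddMonoidHom ι₂.equivariant (galH1Map hV.geomHom hV.geomHom_smul c) := by
      rw [galH1Map_galH1Map]; rfl
    have := galH1Map_galH1Map_of_comp_eq_nsmul ι₂.toAddMonoidHom ι₂.equivariant g hg hgι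
      (galH1Map hV.geomHom hV.geomHom_smul c)
    rw [← e, hc₁0, map_zero, one_nsmul] at this
    exact this.symm
  exact eq_zero_of_mem_sha_of_galH1Map_geomHom_eq_zero hc hφc

/-- **`Ш(E/ℚ)[3^∞] = ⊥`** for `E = threeTorsionModel (−21/2) (6137/2)`. [cite: CohenPazuki2009, Proposition 2.2] -/
theorem primaryComponent_sha_three_threeTorsionModel :
    AddCommGroup.primaryComponent (threeTorsionModel (-21 / 2 : ℚ) (6137 / 2)).sha 3 = ⊥ :=
  haveI : Fact (Nat.Prime 3) := ⟨Nat.prime_three⟩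
  primaryComponent_sha_eq_bot_of_forall _ forall_mem_sha_three_nsmul_eq_zero

/-- **`t_3(E) = corank_{ℤ₃} Ш(E/ℚ)[3^∞] = 0`** for `E = threeTorsionModel (−21/2) (6137/2)` — the door at
`3` on the cross-prime carrier, UNCONDITIONALLY, by complete `3`-isogeny descent (no Iwasawa theory,
no `p`-adic `L`-function). [cite: CohenPazuki2009, Proposition 2.2] [cite: SilvermanAEC2009, Thm. X.4.2 (a)] -/
theorem shaCorank_three_threeTorsionModel : (threeTorsionModel (-21 / 2 : ℚ) (6137 / 2)).shaCorank 3 = 0 :=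
  haveI : Fact (Nat.Prime 3) := ⟨Nat.prime_three⟩
  shaCorank_eq_zero_of_forall _ 3 forall_mem_sha_three_nsmul_eq_zero

/-- **The carrier in its `2`-torsion normal form is `ℚ`-isomorphic to the three-torsion model**:
`⟨1/2, −361, 0, 0⟩ • threeTorsionModel (−21/2) (6137/2) = [0, −3891, 0, 3950784, 0]`.
[cite: CohenPazuki2009, §1.2] -/
theorem variableChange_threeTorsionModel_eq :
    (⟨Units.mk0 (1 / 2 : ℚ) (by norm_num), -361, 0, 0⟩ : VariableChange ℚ) •
        threeTorsionModel (-21 / 2 : ℚ) (6137 / 2) = ⟨0, -3891, 0, 3950784, 0⟩ := by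
  ext <;> simp [threeTorsionModel, variableChange_a₁, variableChange_a₂, variableChange_a₃, variableChange_a₄,
    variableChange_a₆] <;> norm_num

end Carrier6137

end Literature.NumberTheory.EllipticCurves

end
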